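import Literature.NumberTheory.Transcendental.SeedingBlocks
import Literature.NumberTheory.DiophantineApproximation.DiscrepancyNumericalIntegration
import Mathlib.Data.Finset.Fin
import Mathlib.Tactic
import HarnessLib

/-!
# Block sums of the minimal exponent (CDT §6.4, eqs. (6.16)–(6.17))

Calegari–Dimitrov–Tang, arXiv:2408.15403, §6.4 "Seeding" (p. 51): the minimal exponent
`𝐧 ∈ (m+δ)D · P_ε^d` of the auxiliary function is sorted, `n_1 ≤ ⋯ ≤ n_d`, the index set is cut
into the `l+1` blocks `γ_k d/m ≤ j < γ_{k+1} d/m` of §6.4, the map `φ_k` is used in the variables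
of block `k`, and then (eq. (6.16)) `[𝐳^𝐧] G = β · exp(Σ_k (Σ_{j ∈ block k} n_j) log φ_k'(0))`
with (eq. (6.17), from Corollary 62)
`(1−2ε)(γ_{k+1}²−γ_k²) α/m² ≤ Σ_{j ∈ block k} n_j ≤ (1+2ε)²(γ_{k+1}²−γ_k²) α/m²`.
In §6.5.3 (after eq. (6.22)) the block sums are recombined by "an Abel summation … (recalling for
the boundary terms that `γ_{l+1} = m` and `γ_0 = 0`)":
`(1/m²) Σ_{k=0}^{l} (γ_{k+1}²−γ_k²) log|φ_k'(0)| = log|φ_l'(0)| − (1/m²) Σ_{k=1}^{l} γ_k² log(|φ_k'(0)|/|φ_{k−1}'(0)|)`.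

This file provides, for a normalised exponent `𝐭 = 𝐧/L ∈ [0,1]^d` of box discrepancy `≤ ε`:

* `SeedData.exists_mem_block`, `SeedData.eq_of_mem_block` — the blocks of `SeedingBlocks`
  partition the ranks `{0,…,d−1}`;
* `seedBlk` — the block assignment `s ↦ k(s)` by the rank of `t_s` (variables relabelled so that
  `𝐭` is sorted), with `blockCard (seedBlk …) k = d^{(k)}` (`blockCard_seedBlk`);
* `abs_sum_blockOf_sub_le` — eq. (6.17) in the explicit form
  `|Σ_{k(s)=k} t_s − (γ_{k+1}²−γ_k²) d/(2m²)| ≤ ε d^{(k)} + 3`;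
* `abs_sum_mul_sub_le` — weighted over the blocks,
  `|Σ_s t_s c_{k(s)} − (d/(2m²)) Σ_k (γ_{k+1}²−γ_k²) c_k| ≤ (max_k |c_k|)(εd + 3(l+1))`;
* `abel_sum_sq_diff` — the Abel summation identity.

No named facts.

## References

* [CalegariDimitrovTang2024] arXiv:2408.15403, §6.4 eqs. (6.16)–(6.17) (p. 51); §6.5.3
  (Abel summation, p. 53); §6.2 Corollary 62 eq. (6.12).
-/

noncomputable section

open Finset Literature.NumberTheory.DiophantineApproximation.Discrepancy

namespace Literature.NumberTheory.Transcendental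

namespace CalegariDimitrovTang

variable {l : ℕ} {γ : Fin (l + 2) → ℝ} {m : ℕ}

namespace SeedData

/-- `⌈γ_k d/m⌉ ≤ d`. [folklore] -/
theorem blockStart_le (h : SeedData γ m) (d : ℕ) (k : Fin (l + 2)) : blockStart γ m d k ≤ d := by
  have := h.blockStart_mono d (Fin.le_last k)
  rwa [h.blockStart_last] at this

/-- Ranks in a block are `< d`. [folklore] -/
theorem block_lt (h : SeedData γ m) (d : ℕ) (k : Fin (l + 1)) : ∀ j ∈ block γ m d k, j < d :=
  fun _ hj => lt_of_lt_of_le (Finset.mem_Ico.mp hj).2 (h.blockStart_le d _)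

/-- **The blocks cover the ranks**: every `j < d` lies in some block. [cite:
CalegariDimitrovTang2024, §6.4 (p. 51)] -/
theorem exists_mem_block (h : SeedData γ m) {d j : ℕ} (hj : j < d) : ∃ k, j ∈ block γ m d k := by
  classical
  set T : Finset (Fin (l + 2)) := univ.filter fun k => blockStart γ m d k ≤ j with hT
  have h0 : (0 : Fin (l + 2)) ∈ T := by
    rw [hT, mem_filter]; exact ⟨mem_univ _, by rw [h.blockStart_zero]; exact Nat.zero_le _⟩
  have hne : T.Nonempty := ⟨0, h0⟩
  have hk₀T : T.max' hne ∈ T := T.max'_mem hne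
  have hk₀le : blockStart γ m d (T.max' hne) ≤ j := (mem_filter.mp hk₀T).2
  have hlast : T.max' hne ≠ Fin.last (l + 1) := by
    intro heq; rw [heq, h.blockStart_last] at hk₀le; omega
  refine ⟨(T.max' hne).castPred hlast, ?_⟩
  rw [block, Finset.mem_Ico, Fin.castSucc_castPred]
  refine ⟨hk₀le, ?_⟩
  by_contra hlt
  have hmem : ((T.max' hne).castPred hlast).succ ∈ T := mem_filter.mpr ⟨mem_univ _, not_lt.mp hlt⟩
  have hle : ((T.max' hne).castPred hlast).succ ≤ T.max' hne := T.le_max' _ hmem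
  have hlt' : T.max' hne < ((T.max' hne).castPred hlast).succ := by
    conv_lhs => rw [← Fin.castSucc_castPred (T.max' hne) hlast]
    exact Fin.castSucc_lt_succ
  exact absurd hle (not_le.mpr hlt')

/-- **The blocks are disjoint**: a rank lies in at most one block. [folklore] -/
theorem eq_of_mem_block (h : SeedData γ m) {d j : ℕ} {k k' : Fin (l + 1)} (hk : j ∈ block γ m d k)
    (hk' : j ∈ block γ m d k') : k = k' := by
  rw [block, Finset.mem_Ico] at hk hk'
  by_contra hne
  rcases lt_or_gt_of_ne hne with hlt | hlt
  · have hmono := h.blockStart_mono d (show k.succ ≤ k'.castSucc from hlt)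
    omega
  · have hmono := h.blockStart_mono d (show k'.succ ≤ k.castSucc from hlt)
    omega

end SeedData

/-! ### The block assignment by ranks -/

variable {d : ℕ}

/-- The rank of `t_s` in the increasing rearrangement of `𝐭`. [folklore] -/
def rankOf (t : Fin d → ℝ) (s : Fin d) : Fin d := (Tuple.sort t)⁻¹ s

/-- **The seeding block assignment** `s ↦ k(s)`: variable `s` goes to block `k` iff the rank of
`t_s` lies in `[⌈γ_k d/m⌉, ⌈γ_{k+1} d/m⌉)` (CDT relabel the variables so that `𝐧` is sorted and
then cut `{1,…,d}` at the `⌈γ_k d/m⌉`). [cite: CalegariDimitrovTang2024, §6.4 (p. 51)] -/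
def seedBlk (h : SeedData γ m) (t : Fin d → ℝ) (s : Fin d) : Fin (l + 1) :=
  Classical.choose (h.exists_mem_block (rankOf t s).isLt)

/-- The defining property of `seedBlk`. [folklore] -/
theorem rankOf_mem_block (h : SeedData γ m) (t : Fin d → ℝ) (s : Fin d) :
    ((rankOf t s : Fin d) : ℕ) ∈ SeedData.block γ m d (seedBlk h t s) :=
  Classical.choose_spec (h.exists_mem_block (rankOf t s).isLt)

/-- `k(s) = k ↔ rank(s) ∈ block k`. [folklore] -/
theorem seedBlk_eq_iff (h : SeedData γ m) (t : Fin d → ℝ) (s : Fin d) (k : Fin (l + 1)) :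
    seedBlk h t s = k ↔ ((rankOf t s : Fin d) : ℕ) ∈ SeedData.block γ m d k := by
  constructor
  · rintro rfl; exact rankOf_mem_block h t s
  · intro hk; exact h.eq_of_mem_block (rankOf_mem_block h t s) hk

/-- The variables of block `k` are the `sort t`-images of the ranks in block `k`. [folklore] -/
theorem blockOf_seedBlk (h : SeedData γ m) (t : Fin d → ℝ) (k : Fin (l + 1)) :
    blockOf (seedBlk h t) k =
      ((SeedData.block γ m d k).attachFin (h.block_lt d k)).map (Tuple.sort t).toEmbedding := by
  ext s
  simp only [blockOf, mem_filter, Finset.mem_map, Finset.mem_attachFin, Equiv.toEmbedding_apply]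
  rw [seedBlk_eq_iff]
  constructor
  · intro hs
    exact ⟨rankOf t s, hs.2, by simp [rankOf]⟩
  · rintro ⟨j, hj, rfl⟩
    refine ⟨mem_univ _, ?_⟩
    simpa [rankOf] using hj

/-- **`#{s : k(s) = k} = d^{(k)}`**: the block sizes of the seeding assignment are the block
lengths of `SeedingBlocks`. [cite: CalegariDimitrovTang2024, §6.5.4 (`d^{(k)} = ⌈γ_{k+1}d/m⌉ −
⌈γ_k d/m⌉`)] -/
theorem blockCard_seedBlk (h : SeedData γ m) (t : Fin d → ℝ) (k : Fin (l + 1)) :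
    blockCard (seedBlk h t) k = blockLen γ m d k := by
  rw [blockCard, blockOf_seedBlk, Finset.card_map, Finset.card_attachFin, SeedData.card_block]

/-- Sums over the variables of block `k` are sums over the ranks in block `k` of the order
statistics. [folklore] -/
theorem sum_blockOf_seedBlk (h : SeedData γ m) (t : Fin d → ℝ) (k : Fin (l + 1)) (F : Fin d → ℝ) :
    ∑ s ∈ blockOf (seedBlk h t) k, F s =
      ∑ j ∈ (SeedData.block γ m d k).attachFin (h.block_lt d k), F (Tuple.sort t j) := by
  rw [blockOf_seedBlk, Finset.sum_map]
  rfl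

/-! ### Eq. (6.17): the block sums of a well-distributed exponent -/

/-- **CDT eq. (6.17) (normalised, explicit form).** If `𝐭 ∈ [0,1]^d` has box discrepancy `≤ ε`,
then for every block `k` of the seeding assignment,
`|Σ_{k(s)=k} t_s − (γ_{k+1}² − γ_k²) d/(2m²)| ≤ ε d^{(k)} + 3`.
(For `𝐭 = 𝐧/L`, `L ≈ (m+δ)D`, this is `Σ_{j∈block k} n_j = (γ_{k+1}²−γ_k²) α/m² · (1 + O(ε)) + O(L)`.)
[cite: CalegariDimitrovTang2024, §6.4 eq. (6.17) (p. 51), via Corollary 62 eq. (6.12)] -/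
theorem abs_sum_blockOf_sub_le (h : SeedData γ m) {t : Fin d → ℝ} (ht0 : ∀ s, 0 ≤ t s)
    (ht1 : ∀ s, t s ≤ 1) {ε : ℝ} (htD : boxDiscrepancy t ≤ ε) (k : Fin (l + 1)) :
    |∑ s ∈ blockOf (seedBlk h t) k, t s -
        ((γ k.succ) ^ 2 - (γ k.castSucc) ^ 2) * d / (2 * (m : ℝ) ^ 2)| ≤ ε * blockLen γ m d k + 3 := by
  have hm : (0 : ℝ) < m := by exact_mod_cast h.m_pos
  rcases Nat.eq_zero_or_pos d with hd0 | hdpos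
  · subst hd0
    have hbl : blockLen γ m 0 k = 0 := by simp [blockLen, blockStart]
    have hsum : ∑ s ∈ blockOf (seedBlk h t) k, t s = 0 := Finset.sum_eq_zero fun s _ => s.elim0
    rw [hsum, hbl]
    norm_num
  have hdr : (0 : ℝ) < d := by exact_mod_cast hdpos
  rw [sum_blockOf_seedBlk h t k t]
  have hcard : ((SeedData.block γ m d k).attachFin (h.block_lt d k)).card = blockLen γ m d k := by
    rw [Finset.card_attachFin, SeedData.card_block]
  -- order statistics pinned to the ranks (Corollary 62, eq. (6.12))
  have h1 := abs_sum_orderStat_sub_le t ht0 ht1 htD ((SeedData.block γ m d k).attachFin (h.block_lt d k))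
  rw [hcard] at h1
  have hsumS : ∑ j ∈ (SeedData.block γ m d k).attachFin (h.block_lt d k), (((j : Fin d) : ℕ) + 1 : ℝ) / d =
      (∑ j ∈ SeedData.block γ m d k, ((j : ℝ) + 1)) / d := by
    rw [Finset.sum_div]
    conv_rhs => rw [← Finset.image_val_attachFin (h.block_lt d k)]
    rw [Finset.sum_image fun x _ y _ hxy => Fin.ext hxy]
  rw [hsumS] at h1
  -- the rank-window sum (eq. (6.17) arithmetic)
  have h2 := h.abs_two_mul_sum_block_sub_le d k
  have h3 : |(∑ j ∈ SeedData.block γ m d k, ((j : ℝ) + 1)) / d -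
      ((γ k.succ) ^ 2 - (γ k.castSucc) ^ 2) * d / (2 * (m : ℝ) ^ 2)| ≤ 3 := by
    have hγm : γ k.succ ≤ m := h.le_m _
    have hγ0 : 0 ≤ γ k.succ := h.nonneg _
    have hd1 : (1 : ℝ) ≤ d := by exact_mod_cast hdpos
    have e1 : (∑ j ∈ SeedData.block γ m d k, ((j : ℝ) + 1)) / d -
        ((γ k.succ) ^ 2 - (γ k.castSucc) ^ 2) * d / (2 * (m : ℝ) ^ 2) =
        ((∑ j ∈ SeedData.block γ m d k, ((j : ℝ) + 1)) * 2 -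
          ((γ k.succ * d / m) ^ 2 - (γ k.castSucc * d / m) ^ 2)) / (2 * d) := by
      field_simp
    rw [e1, abs_div, abs_of_pos (by positivity : (0 : ℝ) < 2 * d), div_le_iff₀ (by positivity)]
    refine h2.trans ?_
    have : γ k.succ * d / m ≤ d := by
      rw [div_le_iff₀ hm]; nlinarith
    nlinarith
  -- combine
  have e2 : ∑ j ∈ (SeedData.block γ m d k).attachFin (h.block_lt d k), t (Tuple.sort t j) -
      ((γ k.succ) ^ 2 - (γ k.castSucc) ^ 2) * d / (2 * (m : ℝ) ^ 2) =
      (∑ j ∈ (SeedData.block γ m d k).attachFin (h.block_lt d k), t (Tuple.sort t j) -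
        (∑ j ∈ SeedData.block γ m d k, ((j : ℝ) + 1)) / d) +
      ((∑ j ∈ SeedData.block γ m d k, ((j : ℝ) + 1)) / d -
        ((γ k.succ) ^ 2 - (γ k.castSucc) ^ 2) * d / (2 * (m : ℝ) ^ 2)) := by ring
  rw [e2]
  exact (abs_add_le _ _).trans (add_le_add h1 h3)

/-- **Eq. (6.17) summed against block weights**: for weights `c_k` (in CDT `c_k = log|φ_k'(0)|`),
`|Σ_s t_s c_{k(s)} − (d/(2m²)) Σ_k (γ_{k+1}²−γ_k²) c_k| ≤ (max_k |c_k|)·(εd + 3(l+1))`.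
[cite: CalegariDimitrovTang2024, §6.4 eqs. (6.16)–(6.17) and §6.5.3 eq. after (6.22) (p. 53)] -/
theorem abs_sum_mul_sub_le (h : SeedData γ m) {t : Fin d → ℝ} (ht0 : ∀ s, 0 ≤ t s)
    (ht1 : ∀ s, t s ≤ 1) {ε : ℝ} (htD : boxDiscrepancy t ≤ ε) (c : Fin (l + 1) → ℝ)
    {Cc : ℝ} (hCc : ∀ k, |c k| ≤ Cc) :
    |∑ s, t s * c (seedBlk h t s) -
        (d : ℝ) / (2 * (m : ℝ) ^ 2) * ∑ k, ((γ k.succ) ^ 2 - (γ k.castSucc) ^ 2) * c k| ≤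
      Cc * (ε * d + 3 * (l + 1)) := by
  have hCc0 : 0 ≤ Cc := (abs_nonneg _).trans (hCc 0)
  -- fiberwise
  have hfib : ∑ s, t s * c (seedBlk h t s) = ∑ k, c k * ∑ s ∈ blockOf (seedBlk h t) k, t s := by
    rw [← Finset.sum_fiberwise univ (seedBlk h t) (fun s => t s * c (seedBlk h t s))]
    refine Finset.sum_congr rfl fun k _ => ?_
    rw [Finset.mul_sum]
    refine Finset.sum_congr rfl fun s hs => ?_
    rw [(Finset.mem_filter.mp hs).2, mul_comm]
  rw [hfib, Finset.mul_sum, ← Finset.sum_sub_distrib]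
  have hterm : ∀ k, |c k * ∑ s ∈ blockOf (seedBlk h t) k, t s -
      (d : ℝ) / (2 * (m : ℝ) ^ 2) * (((γ k.succ) ^ 2 - (γ k.castSucc) ^ 2) * c k)| ≤
      Cc * (ε * blockLen γ m d k + 3) := by
    intro k
    have hb := abs_sum_blockOf_sub_le h ht0 ht1 htD k
    have e : c k * ∑ s ∈ blockOf (seedBlk h t) k, t s -
        (d : ℝ) / (2 * (m : ℝ) ^ 2) * (((γ k.succ) ^ 2 - (γ k.castSucc) ^ 2) * c k) =
        c k * (∑ s ∈ blockOf (seedBlk h t) k, t s -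
          ((γ k.succ) ^ 2 - (γ k.castSucc) ^ 2) * d / (2 * (m : ℝ) ^ 2)) := by ring
    rw [e, abs_mul]
    exact mul_le_mul (hCc k) hb (abs_nonneg _) hCc0
  calc |∑ k, (c k * ∑ s ∈ blockOf (seedBlk h t) k, t s -
          (d : ℝ) / (2 * (m : ℝ) ^ 2) * (((γ k.succ) ^ 2 - (γ k.castSucc) ^ 2) * c k))|
      ≤ ∑ k, |c k * ∑ s ∈ blockOf (seedBlk h t) k, t s -
          (d : ℝ) / (2 * (m : ℝ) ^ 2) * (((γ k.succ) ^ 2 - (γ k.castSucc) ^ 2) * c k)| :=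
        Finset.abs_sum_le_sum_abs _ _
    _ ≤ ∑ k, Cc * (ε * blockLen γ m d k + 3) := Finset.sum_le_sum fun k _ => hterm k
    _ = Cc * (ε * d + 3 * (l + 1)) := by
        rw [← Finset.mul_sum, Finset.sum_add_distrib, ← Finset.mul_sum, Finset.sum_const, card_univ,
          Fintype.card_fin]
        have : ∑ k, (blockLen γ m d k : ℝ) = d := by exact_mod_cast h.sum_blockLen d
        rw [this, nsmul_eq_mul]
        push_cast; ring

/-! ### The Abel summation -/

/-- **Abel summation** with `γ_0 = 0`:
`Σ_{k=0}^{l} (γ_{k+1}² − γ_k²) c_k = γ_{l+1}² c_l − Σ_{k=1}^{l} γ_k² (c_k − c_{k−1})`.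
[cite: CalegariDimitrovTang2024, §6.5.3 ("apply an Abel summation to obtain (recalling for the
boundary terms that `γ_{l+1} = m` and `γ_0 = 0`)", p. 53)] -/
theorem abel_sum_sq_diff (g c : ℕ → ℝ) (hg : g 0 = 0) (l : ℕ) :
    ∑ k ∈ Finset.range (l + 1), (g (k + 1) ^ 2 - g k ^ 2) * c k =
      g (l + 1) ^ 2 * c l - ∑ k ∈ Finset.Ico 1 (l + 1), g k ^ 2 * (c k - c (k - 1)) := by
  induction l with
  | zero => simp [hg]
  | succ n ih =>
    rw [Finset.sum_range_succ, ih, Finset.sum_Ico_succ_top (by omega : 1 ≤ n + 1)]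
    simp only [Nat.add_sub_cancel]
    ring

/-- The Abel summation in `Fin`-indexed form for seed data (`γ_0 = 0`, `γ_{l+1} = m`):
`Σ_k (γ_{k+1}² − γ_k²) c_k = m² c_l − Σ_{k=1}^{l} γ_k² (c_k − c_{k−1})`.
[cite: CalegariDimitrovTang2024, §6.5.3 (p. 53)] -/
theorem SeedData.abel_sum (h : SeedData γ m) (c : Fin (l + 1) → ℝ) :
    ∑ k : Fin (l + 1), ((γ k.succ) ^ 2 - (γ k.castSucc) ^ 2) * c k =
      (m : ℝ) ^ 2 * c (Fin.last l) -
        ∑ k : Fin l, (γ k.succ.castSucc) ^ 2 * (c k.succ - c k.castSucc) := by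
  -- transfer to `ℕ`-indexed functions
  set g : ℕ → ℝ := fun n => if hn : n < l + 2 then γ ⟨n, hn⟩ else 0 with hgdef
  set c' : ℕ → ℝ := fun n => if hn : n < l + 1 then c ⟨n, hn⟩ else 0 with hc'
  have hg0 : g 0 = 0 := by simp [hgdef, h.zero]
  have key := abel_sum_sq_diff g c' hg0 l
  have lhs : ∑ k : Fin (l + 1), ((γ k.succ) ^ 2 - (γ k.castSucc) ^ 2) * c k =
      ∑ k ∈ Finset.range (l + 1), (g (k + 1) ^ 2 - g k ^ 2) * c' k := by
    rw [← Fin.sum_univ_eq_sum_range]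
    refine Finset.sum_congr rfl fun k _ => ?_
    have hk := k.isLt
    simp only [hgdef, hc', dif_pos hk, dif_pos (show (k : ℕ) + 1 < l + 2 by omega),
      dif_pos (show (k : ℕ) < l + 2 by omega)]
    rfl
  have rhs1 : g (l + 1) ^ 2 * c' l = (m : ℝ) ^ 2 * c (Fin.last l) := by
    simp only [hgdef, hc', dif_pos (show l + 1 < l + 2 by omega), dif_pos (show l < l + 1 by omega)]
    have : (⟨l + 1, (show l + 1 < l + 2 by omega)⟩ : Fin (l + 2)) = Fin.last (l + 1) := rfl
    rw [this, h.last]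
    rfl
  have rhs2 : ∑ k ∈ Finset.Ico 1 (l + 1), g k ^ 2 * (c' k - c' (k - 1)) =
      ∑ k : Fin l, (γ k.succ.castSucc) ^ 2 * (c k.succ - c k.castSucc) := by
    rw [Finset.sum_Ico_eq_sum_range, Nat.add_sub_cancel, ← Fin.sum_univ_eq_sum_range]
    simp only [Nat.add_sub_cancel_left]
    refine Finset.sum_congr rfl fun k _ => ?_
    have hk := k.isLt
    simp only [hgdef, hc', dif_pos (show 1 + (k : ℕ) < l + 2 by omega),
      dif_pos (show 1 + (k : ℕ) < l + 1 by omega), dif_pos (show (k : ℕ) < l + 1 by omega)]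
    have e1 : (⟨1 + (k : ℕ), (show 1 + (k : ℕ) < l + 2 by omega)⟩ : Fin (l + 2)) = k.succ.castSucc :=
      Fin.ext (by simp [Nat.add_comm])
    have e2 : (⟨1 + (k : ℕ), (show 1 + (k : ℕ) < l + 1 by omega)⟩ : Fin (l + 1)) = k.succ :=
      Fin.ext (by simp [Nat.add_comm])
    have e3 : (⟨(k : ℕ), (show (k : ℕ) < l + 1 by omega)⟩ : Fin (l + 1)) = k.castSucc := Fin.ext rfl
    rw [e1, e2, e3]
  rw [lhs, key, rhs1, rhs2]

end CalegariDimitrovTang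

end Literature.NumberTheory.Transcendental
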